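import Summits.Ventures.HodgeRepro2.T5RightCosetDecomposition
import Summits.Ventures.HodgeRepro2.T5DoubleCosetTopology

/-!
# T5OrbitHomeomorph — the `q`-th orbit of `[G]/K_f` as the left-coset space `G_∞ ⧸ Γ_q`,
`G_∞`-equivariantly

Cell pub-hodge-repro2, seat p5, Tier 5 (route/T5-N4-p5.md, N4.3 v13 (A3) STEP 1: «The map
G_∞ → Y, g_∞ ↦ [g_∞ g_i] identifies the i-th orbit with Γ_i\G_∞»).  Row 39 identifies the orbit
`range (toFull q) ⊆ FullQuotient H K` with p2's `Component H K q = Γ_q\A` (right cosets,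
`componentHomeomorph`); row 61 identifies `Γ_q\A` with the LEFT-coset space `A ⧸ Γ_q` of rows 59 /
65 / 70 by the inversion (`rightRelHomeomorph`, `ι`).  This file composes the two and records the
equivariance, so that the objects of rows 59–72 live on the orbit itself:

* `toFull_smul`: p2's `toFull q : Γ_q\A → [G]/K_f` is `A`-equivariant for row 44's action
  `a • [x] = [x a⁻¹]` on `Γ_q\A` and row 39's action on `[G]/K_f`;
* `orbitHomeomorph H K hK q : A ⧸ Γ_q ≃ₜ range (toFull q)` (`K` open), with
  `coe_orbitHomeomorph_mk` (`[x] ↦ [(x⁻¹, g_q)]`) and **`coe_orbitHomeomorph_smul`**: the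
  homeomorphism intertwines the left action `a • [x] = [a x]` on `A ⧸ Γ_q` with the action of
  `A = G_∞` on `[G]/K_f` — STEP 1's identification «the i-th orbit ≅ Γ_i\G_∞ ≅ G_∞ ⧸ Γ_i» as
  `G_∞`-spaces, in kernel.

Imports rows 39 / 40 / 44 / 61 (and p2's `T5DoubleCosetDecomposition` through them).
Axioms: propext, Classical.choice, Quot.sound.
README §8(d): uses an L-value-free non-vanishing device: NO.
-/

namespace Summit.Ventures.HodgeRepro2.T5OrbitHomeomorph

open Summit.Ventures.HodgeRepro2.T5DoubleCosetDecomposition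
open Summit.Ventures.HodgeRepro2.T5DoubleCosetTopology
open Summit.Ventures.HodgeRepro2.T5RightCosetAction
open Summit.Ventures.HodgeRepro2.T5RightCosetDecomposition
open Summit.Ventures.HodgeRepro2.T5CocompactInversion (rightRelHomeomorph)

variable {A B : Type*} [Group A] [Group B] (H : Subgroup (A × B)) (K : Subgroup B)

/-- `toFull q` on a right coset: `toFull q [x] = [(x, g_q)]`. -/
theorem toFull_rmk (q : FiniteQuotient H K) (x : A) :
    toFull q (rmk (gammaGroup H K (rep q)) x) = DoubleCoset.mk H (rightLevel A K) (x, rep q) :=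
  rfl

/-- **`toFull q` is `A`-equivariant**: `toFull q (a • c) = a • toFull q c` (row 44's action
`a • [x] = [x a⁻¹]` on `Γ_q\A`, row 39's action `a • [p] = [p · (a⁻¹, 1)]` on `[G]/K_f`). -/
theorem toFull_smul (q : FiniteQuotient H K) (a : A) (c : Component H K q) :
    toFull q (a • c) = a • toFull q c := by
  induction c using Quotient.inductionOn' with
  | h x =>
    change toFull q (a • rmk (gammaGroup H K (rep q)) x) = a • toFull q (rmk _ x)
    rw [smul_rmk, toFull_rmk, toFull_rmk, smul_mk]
    congr 1
    ext <;> simp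

variable [TopologicalSpace A] [TopologicalSpace B] [IsTopologicalGroup A] [ContinuousMul B]

/-- **The `q`-th orbit as a left-coset space**: `A ⧸ Γ_q ≃ₜ range (toFull q)` — row 61's inversion
`A ⧸ Γ_q ≃ₜ Γ_q\A` followed by row 39's `componentHomeomorph`. -/
noncomputable def orbitHomeomorph (hK : IsOpen (K : Set B)) (q : FiniteQuotient H K) :
    (A ⧸ gammaGroup H K (rep q)) ≃ₜ Set.range (toFull q) :=
  (rightRelHomeomorph (gammaGroup H K (rep q))).symm.trans (componentHomeomorph H K hK q)

/-- The inverse of row 61's inversion on classes: `(rightRelHomeomorph Γ).symm [x] = [x⁻¹]`. -/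
theorem rightRelHomeomorph_symm_mk (Γ : Subgroup A) (x : A) :
    (rightRelHomeomorph Γ).symm (x : A ⧸ Γ) = rmk Γ x⁻¹ := by
  rw [Homeomorph.symm_apply_eq]
  exact ((ι_rmk Γ x⁻¹).trans (by rw [inv_inv])).symm

/-- `orbitHomeomorph` on classes: `[x] ↦ [(x⁻¹, g_q)]`. -/
theorem coe_orbitHomeomorph_mk (hK : IsOpen (K : Set B)) (q : FiniteQuotient H K) (x : A) :
    ((orbitHomeomorph H K hK q (x : A ⧸ gammaGroup H K (rep q)) : Set.range (toFull q)) :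
      FullQuotient H K) = DoubleCoset.mk H (rightLevel A K) (x⁻¹, rep q) := by
  unfold orbitHomeomorph
  rw [Homeomorph.trans_apply, rightRelHomeomorph_symm_mk, componentHomeomorph_apply_coe,
    toFull_rmk]

/-- **Equivariance**: `orbitHomeomorph` intertwines the left action `a • [x] = [a x]` on `A ⧸ Γ_q`
with the action of `A` on `[G]/K_f`. -/
theorem coe_orbitHomeomorph_smul (hK : IsOpen (K : Set B)) (q : FiniteQuotient H K) (a : A)
    (y : A ⧸ gammaGroup H K (rep q)) :
    ((orbitHomeomorph H K hK q (a • y) : Set.range (toFull q)) : FullQuotient H K) =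
      a • ((orbitHomeomorph H K hK q y : Set.range (toFull q)) : FullQuotient H K) := by
  induction y using QuotientGroup.induction_on with
  | H x =>
    rw [MulAction.Quotient.smul_mk, coe_orbitHomeomorph_mk, coe_orbitHomeomorph_mk, smul_mk]
    congr 1
    ext <;> simp [mul_inv_rev]

end Summit.Ventures.HodgeRepro2.T5OrbitHomeomorph
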